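import Literature.MathematicalPhysics.QuantumFieldTheory.Balaban1983to89.B2Eq243RegionsTower

/-!
# `Balaban1983to89.B2Eq350TowerVolume` — T. Bałaban, *(Higgs)₂,₃ quantum fields in a finite volume. II. An upper bound*,
Commun. Math. Phys. **86** (1982) 555–594 [Balaban1982Higgs2] pp. 592–593, (3.43)–(3.45) and (3.48)–(3.50): **the volume
`|Λ₀^{(k)c}|` of the complement of the step-`(k+1)` small-field region, for the regions CONSTRUCTED on the concrete
(Higgs)₂,₃ tori (`B2Eq243RegionsTower.towerRegion`), is controlled by the NUMBERS of large-field points of the steps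
`0, 1, …, k`** — the printed covering *"Λ₀^{(k)c} ⊂ ⋃_{□∈𝒟_k} □"* by cubes around the current large fields (`𝒞_k`) and
around the rescaled earlier ones (the *"corridors"* of (3.49)), here as balls of the distance (I.1.3) around the block-map
images of the earlier large-field points, with explicit radii, and the count `|Λ_i^{(k)c}| ≤ Σ_{l ≤ k} |bad_l| · (2ρ_{k,l} + 1)^d`

statement-level skeleton of published theorems with citation tags; proofs where landed; nothing here is a claim about the Yang–Mills mass gap

PDF held: `paper:balaban1982-cmp86-higgs23-ii` (journal page = PDF page + 554); pp. 592–593 [PDF 38–39] READ AS IMAGES on the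
×2 renders `run/shared/lean/pub/pub-balaban/b2b-balaban-ref1/pages/1982-cmp86-higgs23-II/…-p038-x2.png`, `…-p039-x2.png`.

CITATION HEADER (lean-in-tree rule).  lit-balaban typed skeleton (HOME `run/shared/lean/pub/lit-balaban/`), typer line
(concrete carriers), gen 9, sequel of `B2Eq255RegionsWindow`/`B2Eq243RegionsTower`.  SKELETON rows served: **B2.Eq3.47**
((3.43)–(3.54), owner r02; second reader r14; the members (3.43)–(3.45), (3.48)–(3.50) are the geometric covering/counting
statements — r14's abstract `B2Sect3C.Bound350`/`Bound352` take their printed cardinality consequence as a LEAF; this file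
proves the covering and the count for the constructed tower), **B2.Eq3.42** (whose proof from the leaves is r14's
`B2Sect3C.claim342_of_leaves350` and p23's (3.46) ⇒ (3.47) files), B2.Eq2.43/B2.Eq2.55 (the tower).  NOTHING of record is
restated: the one-level count is gen-8's `B2Eq28RegionsConcrete.card_compl_region_le` (the case `k = 0` here), balls and
their cardinality are gen-8's `ball`/`card_ball_le`, the window thickness is `B2Eq255RegionsWindow.exists_seed_near_of_not_mem_regionRel`.

THE SOURCE TEXT, pp. 592–593 [PDF 38–39], verbatim.  *"Let us consider a regular partition of T₁ into a lattice of cubes,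
each cube is a sum of large blocks and a length of its side is bigger r(ε), and less 2r(ε). Let us define 𝒞₀ as the set of
the cubes having common points with Λ₀^{(0)c}. Thus Λ₀^{(0)c} ⊂ ⋃_{□∈𝒞₀} □ = ∪𝒞₀. (3.43) Now if to every element of the set
P_v^{(0)}∪…∪R_s^{(0)} we assign a cube □ having a common point with this element and 3^d − 1 cubes neighbouring with □, then
the sum of all these cubes contains the set ∪𝒞₀. It is so because a distance of each large block contained in Λ₀^{(0)c}
from the set P_v^{(0)}∪…∪R_s^{(0)} is ≦ r(ε). Thus we have |𝒞₀| ≦ 3^d(|P_v^{(0)}| + … + |R_s^{(0)}|). (3.44) … In a similar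
way we divide T₁^{(k)} into a regular lattice of cubes … We define 𝒞_k as the set of these cubes, which have the common
points with Λ₇^{(k−1)′}∩Λ₀^{(k)c}. … |𝒞_k| ≦ 3^d(|P_v^{(k)}| + … + |R_s^{(k)}|). (3.45)"*; p. 593: *"Now we will express
|Λ₀^{(k)c}| by the help of |𝒞_k|. We will construct a sequence 𝒟₀, 𝒟₁, …, 𝒟_{K−1} of families of cubes with the
properties that Λ₀^{(k)c} is contained in the sum of cubes of the family 𝒟_k. We take 𝒟₀ = 𝒞₀. Of course
Λ₀^{(0)c} ⊂ ⋃_{□∈𝒟₀} □ and |Λ₀^{(0)c}| ≦ (2r(ε))^d|𝒞₀|. (3.48) To each cube from 𝒟₀ we add a “corridor” consisting of large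
blocks and of thickness > 9r(ε), but < 10r(ε). We get a cube with a side of length < 22r(ε) and we apply the operation ′
to it, i.e. we take the set of small blocks. After rescaling we get a cube of the lattice T₁^{(1)} with a side of length
< L⁻¹22r(ε). We add 𝒞₁ to the obtained set of cubes and we denote the sum by 𝒟₁. From the definition of Λ₀^{(1)} we
have Λ₀^{(1)c} ⊂ ⋃_{□∈𝒟₁} □ and |Λ₀^{(1)c}| ≦ (L⁻¹22r(ε))^d|𝒞₀| + (2r(Lε))^d|𝒞₁|. (3.49) We continue this procedure
and we get a sequence of families of cubes 𝒟₀, 𝒟₁, 𝒟₂, …, 𝒟_{K−1} with the following properties Λ₀^{(k)c} ⊂ ⋃_{□∈𝒟_k} □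
and |Λ₀^{(k)c}| ≦ (L^{−k}22r(ε) + L^{−(k−1)}20r(Lε) + … + L⁻¹20r(L^{k−1}ε))^d|𝒞₀| + … + (2r(Lᵏε))^d|𝒞_k|. (3.50)"*

DICTIONARY (print ↦ Lean).  `Λ_i^{(k)}` ↦ `towerRegion bad r k i` (the constructed tower; `bad l : Finset (Site P l)` the
large-field points of step `l + 1`, `r l` ↦ `r(Lˡε)` in lattice units of `T₁^{(l)}`); *"the operation ′ … After
rescaling"* ↦ the block map `HiggsLattice.blockOf : T^{(l)} → T^{(l+1)}`, under which distances shrink by `L` up to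
rounding (`tdist_blockOf_le`: `|x₁ − y₁| ≤ |x − y|/L + 1`, `l < K`); the earlier large-field points seen from level `k` ↦
`badImg bad k l` (the `(k−l)`-fold block-map image of `bad l`, `|badImg| ≤ |bad_l|`); the cubes of 𝒟_k ↦ balls of (I.1.3)
(`B2Eq28RegionsConcrete.ball`) around the points of `badImg bad k l`, of radius `rad r k l i` — the printed recursion
*"corridor + rescaling"*: `rad r (k+1) l i = i·(r_{k+1} + 2(LM−1)) + (LM−1) + rad r k l 7 / L + 1` for `l ≤ k` (the `Λ₇^{(k)c}`
corridor, rescaled, plus the straddling large blocks and the rounding), `rad r k k i = i·(r_k + 2(LM−1)) + r_k + (LM−1)`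
(gen-8's one-level thickness); `|·|` ↦ `Finset.card`.

WHAT THIS FILE PROVES (0 sorry; standard axioms; definitions with bodies + theorems; no `Prop`-valued definition).
§1 the rescaling step: `coord_scale_le` (one coordinate), **`mul_tdist_blockOf_le`** (`L·|x₁ − y₁| ≤ |x − y| + (L − 1)`,
   `l < K`), **`tdist_blockOf_le`** (`|x₁ − y₁| ≤ |x − y|/L + 1`), `tdist_blockOf_le_real`.
§2 `badImg` (images of the large-field points), `badImg_self`, `badImg_succ_of_ne`, `card_badImg_le` (`≤ |bad_l|`),
   `badImg_eq_empty` (`l > k`).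
§3 the radii `rad` and **`exists_badImg_near_of_not_mem_towerRegion`**: every point of `Λ_i^{(k)c}` (`k ≤ K`) is within `rad r k l i`
   of the level-`k` image of a large-field point of some step `l ≤ k` — the covering *"Λ₀^{(k)c} ⊂ ⋃_{□∈𝒟_k} □"* of (3.48)–(3.50)
   for the constructed regions.
§4 the count: `compl_towerRegion_subset_biUnion`, **`card_compl_towerRegion_le`**
   (`|Λ_i^{(k)c}| ≤ Σ_{l ≤ k} |bad_l| · (2⌊rad r k l i⌋ + 1)^d` — the printed shape of (3.50): per earlier step a coefficient to
   the `d`-th power times the number of its large-field elements), `card_compl_towerRegion_zero_le`.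
HONEST SCOPE.  (a) The print counts CUBES (`|𝒞_l|`, side in `]r, 2r[`) and bounds them by `3^d` times the number of
large-field ELEMENTS ((3.44)/(3.45)); this file counts the large-field POINTS `|bad_l|` directly (each element of
`P_v ∪ … ∪ R_s` occupies `≤ L^d` points, `B2Eq28RegionsConcrete.badSites`), which is the same information up to the factors
`3^d`/`L^d`; the cube families `𝒞_k`, `𝒟_k` themselves are not introduced.  (b) The radii are this construction's
(`(i+1)r + (2i+1)(LM−1)` per level, `+1` per rescaling), not the print's `22r`/`20r`, which presuppose `r(ε) ≫ LM`; their
summation to the `O(1)·r(Lᵏε)^d` of (3.51)–(3.52) (r14's `B2Sect3C.bound352_of_350` shape) is NOT done here.  (c) Levels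
`≤ K` only (the block map wraps correctly only while `T^{(l+1)}` is `L` times coarser).  (d) No field, no measure: value = the
combinatorial geometry of Sect. 3.C made concrete for the constructed regions; NOT summit progress.  Unit `lit-balaban-typer`
gen 9 (literature-prover-lit-balaban-typer-g9-0); HOME/FILED.md records the proposal.
-/

open scoped BigOperators

namespace Literature.MathematicalPhysics.QuantumFieldTheory.Balaban1983to89.B2Eq350TowerVolume

open HiggsLattice HiggsRescaling B2Eq28RegionsConcrete B2Eq255RegionsWindow B2Eq243RegionsTower
open B2Eq324NestedRegions (prime mem_prime)
open B1Ineq234Concrete (tdist_self)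
open B1Ineq234LevelZero (tdist_comm tdist_triangle_real)

variable {P : HiggsLattice.Params}

/-! ## §1 *"we apply the operation ′ to it … After rescaling"*: the block map shrinks distances by `L` up to rounding -/

section Rescale

/-- `(b − a).val = n − (a − b).val` on `ZMod n` for `a ≠ b`. [folklore] -/
private theorem val_sub_rev {n : ℕ} [NeZero n] {a b : ZMod n} (h : a ≠ b) : (b - a).val = n - (a - b).val := by
  rw [← neg_sub, ZMod.neg_val, if_neg (sub_ne_zero.mpr h)]

/-- One coordinate of the rescaling: for `n = L·m` and the labels `A = ⌊a/L⌋`, `B = ⌊b/L⌋`,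
`L · dist_{ℤ/m}(A, B) ≤ dist_{ℤ/n}(a, b) + (L − 1)` (auxiliary orientation `b ≤ a`). [folklore] -/
private theorem coord_scale_le_aux {n m L : ℕ} [NeZero n] [NeZero m] (hn : n = L * m) (hL : 0 < L)
    (a b : ZMod n) (A B : ZMod m) (hA : A.val = a.val / L) (hB : B.val = b.val / L) (hba : b.val ≤ a.val) :
    L * min (A - B).val (B - A).val ≤ min (a - b).val (b - a).val + (L - 1) := by
  have hBA : B.val ≤ A.val := by rw [hA, hB]; exact Nat.div_le_div_right hba
  have hA1 : L * A.val ≤ a.val := by rw [hA, mul_comm]; exact Nat.div_mul_le_self _ _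
  have hA2 : a.val < L * A.val + L := by rw [hA, mul_comm]; exact Nat.lt_div_mul_add hL
  have hB1 : L * B.val ≤ b.val := by rw [hB, mul_comm]; exact Nat.div_mul_le_self _ _
  have hB2 : b.val < L * B.val + L := by rw [hB, mul_comm]; exact Nat.lt_div_mul_add hL
  have hp : L * B.val ≤ L * A.val := Nat.mul_le_mul_left _ hBA
  have hsubA : (A - B).val = A.val - B.val := ZMod.val_sub hBA
  have hsuba : (a - b).val = a.val - b.val := ZMod.val_sub hba
  have hmval : A.val < m := ZMod.val_lt A
  by_cases hAB : A = B
  · subst hAB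
    simp
  · have hab : a ≠ b := by
      rintro rfl
      exact hAB (ZMod.val_injective _ (by rw [hA, hB]))
    rw [val_sub_rev hAB, val_sub_rev hab, hsubA, hsuba]
    have h1 : L * (A.val - B.val) ≤ (a.val - b.val) + (L - 1) := by
      rw [mul_tsub]; omega
    have h2 : L * (m - (A.val - B.val)) ≤ (n - (a.val - b.val)) + (L - 1) := by
      rw [mul_tsub, mul_tsub, ← hn]; omega
    rw [← min_add_add_right]
    exact le_min (le_trans (Nat.mul_le_mul_left _ (min_le_left _ _)) h1)
      (le_trans (Nat.mul_le_mul_left _ (min_le_right _ _)) h2)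

/-- One coordinate of the rescaling `T^{(l)} → T^{(l+1)}` ((I.1.19)–(I.1.20): the coarse lattice has `L` times fewer sites per
direction; labels `A = ⌊a/L⌋`): `L · dist_{ℤ/m}(A, B) ≤ dist_{ℤ/n}(a, b) + (L − 1)` for `n = L·m`, both orientations.
[cite: Balaban1982Higgs1, (1.20) p.607] -/
theorem coord_scale_le {n m L : ℕ} [NeZero n] [NeZero m] (hn : n = L * m) (hL : 0 < L)
    (a b : ZMod n) (A B : ZMod m) (hA : A.val = a.val / L) (hB : B.val = b.val / L) :
    L * min (A - B).val (B - A).val ≤ min (a - b).val (b - a).val + (L - 1) := by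
  rcases le_total b.val a.val with hba | hab
  · exact coord_scale_le_aux hn hL a b A B hA hB hba
  · rw [min_comm (A - B).val, min_comm (a - b).val]
    exact coord_scale_le_aux hn hL b a B A hB hA hab

/-- `sitesPerDir l μ = L · sitesPerDir (l+1) μ` for `l < K` ((I.1.19)–(I.1.20): `T^{(l+1)}` is `L` times coarser).
[cite: Balaban1982Higgs1, (1.20) p.607] -/
theorem sitesPerDir_eq_L_mul_succ {l : ℕ} (hl : l < P.K) (μ : Fin P.d) :
    P.sitesPerDir l μ = P.L * P.sitesPerDir (l + 1) μ := by
  unfold HiggsLattice.Params.sitesPerDir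
  have h : P.K - l = (P.K - (l + 1)) + 1 := by omega
  rw [h, pow_succ]
  ring

/-- **The rescaling step of (3.49)**: `L · |x₁ − y₁|_{T^{(l+1)}} ≤ |x − y|_{T^{(l)}} + (L − 1)` for the block points `x₁ = blockOf x`,
`y₁ = blockOf y` (`l < K`), in the lattice-unit distances (I.1.3). [cite: Balaban1982Higgs2, (3.49) p.593] -/
theorem mul_tdist_blockOf_le {l : ℕ} (hl : l < P.K) (x y : HiggsLattice.Site P l) :
    P.L * HiggsLattice.Site.tdist (HiggsLattice.blockOf x) (HiggsLattice.blockOf y) ≤ HiggsLattice.Site.tdist x y + (P.L - 1) := by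
  haveI : Nonempty (Fin P.d) := ⟨⟨0, P.hd⟩⟩
  obtain ⟨μ, -, hμ⟩ := Finset.exists_mem_eq_sup (Finset.univ : Finset (Fin P.d)) Finset.univ_nonempty
    (fun μ : Fin P.d => min ((HiggsLattice.blockOf x) μ - (HiggsLattice.blockOf y) μ).val
      ((HiggsLattice.blockOf y) μ - (HiggsLattice.blockOf x) μ).val)
  unfold HiggsLattice.Site.tdist
  rw [hμ]
  have hcoord := coord_scale_le (sitesPerDir_eq_L_mul_succ hl μ) P.hL (x μ) (y μ)
    ((HiggsLattice.blockOf x) μ) ((HiggsLattice.blockOf y) μ)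
    (B1Ineq234Concrete.val_blockOf_all x μ) (B1Ineq234Concrete.val_blockOf_all y μ)
  have hle : min (x μ - y μ).val (y μ - x μ).val ≤
      Finset.univ.sup (fun ν : Fin P.d => min (x ν - y ν).val (y ν - x ν).val) :=
    Finset.le_sup (f := fun ν : Fin P.d => min (x ν - y ν).val (y ν - x ν).val) (Finset.mem_univ μ)
  omega

/-- **`|x₁ − y₁| ≤ |x − y|/L + 1`** (integer division; `l < K`). [cite: Balaban1982Higgs2, (3.49) p.593] -/
theorem tdist_blockOf_le {l : ℕ} (hl : l < P.K) (x y : HiggsLattice.Site P l) :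
    HiggsLattice.Site.tdist (HiggsLattice.blockOf x) (HiggsLattice.blockOf y) ≤ HiggsLattice.Site.tdist x y / P.L + 1 := by
  have h := mul_tdist_blockOf_le hl x y
  have hL := P.hL
  have h1 : HiggsLattice.Site.tdist (HiggsLattice.blockOf x) (HiggsLattice.blockOf y) ≤
      (HiggsLattice.Site.tdist x y + (P.L - 1)) / P.L :=
    (Nat.le_div_iff_mul_le hL).mpr (by rw [mul_comm]; exact h)
  refine h1.trans ?_
  calc (HiggsLattice.Site.tdist x y + (P.L - 1)) / P.L ≤ (HiggsLattice.Site.tdist x y + P.L) / P.L :=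
        Nat.div_le_div_right (by omega)
    _ = HiggsLattice.Site.tdist x y / P.L + 1 := Nat.add_div_right _ hL

/-- The same in real form: `|x₁ − y₁| ≤ |x − y|/L + 1`. [cite: Balaban1982Higgs2, (3.49) p.593] -/
theorem tdist_blockOf_le_real {l : ℕ} (hl : l < P.K) (x y : HiggsLattice.Site P l) :
    (HiggsLattice.Site.tdist (HiggsLattice.blockOf x) (HiggsLattice.blockOf y) : ℝ) ≤
      (HiggsLattice.Site.tdist x y : ℝ) / (P.L : ℝ) + 1 := by
  have h := tdist_blockOf_le hl x y
  have hcast : ((HiggsLattice.Site.tdist x y / P.L : ℕ) : ℝ) ≤ (HiggsLattice.Site.tdist x y : ℝ) / (P.L : ℝ) :=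
    Nat.cast_div_le
  calc (HiggsLattice.Site.tdist (HiggsLattice.blockOf x) (HiggsLattice.blockOf y) : ℝ)
      ≤ ((HiggsLattice.Site.tdist x y / P.L + 1 : ℕ) : ℝ) := by exact_mod_cast h
    _ = ((HiggsLattice.Site.tdist x y / P.L : ℕ) : ℝ) + 1 := by push_cast; ring
    _ ≤ (HiggsLattice.Site.tdist x y : ℝ) / (P.L : ℝ) + 1 := by linarith

end Rescale

/-! ## §2 The earlier large-field points seen from level `k`: block-map images -/

section Images

/-- **The images at level `k` of the large-field points of step `l + 1`**: `badImg bad k l` = `bad l` pushed up by the block map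
`k − l` times (`= bad k` for `l = k`, `= ∅` for `l > k`) — the centres of the rescaled cubes of the families 𝒟_k of (3.49)–(3.50).
[cite: Balaban1982Higgs2, (3.49) p.593] -/
def badImg (bad : (j : ℕ) → Finset (HiggsLattice.Site P j)) : (k : ℕ) → ℕ → Finset (HiggsLattice.Site P k)
  | 0 => fun l => if l = 0 then bad 0 else ∅
  | k + 1 => fun l => if l = k + 1 then bad (k + 1) else (badImg bad k l).image HiggsLattice.blockOf

variable {bad : (j : ℕ) → Finset (HiggsLattice.Site P j)}

/-- At its own level the image is the large-field set itself. [cite: Balaban1982Higgs2, (3.45) p.592] -/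
theorem badImg_self : ∀ k : ℕ, badImg bad k k = bad k
  | 0 => by simp [badImg]
  | _ + 1 => if_pos rfl

/-- One level up (`l ≠ k + 1`): the image at level `k + 1` is the block-map image of the image at level `k`.
[cite: Balaban1982Higgs2, (3.49) p.593] -/
theorem badImg_succ_of_ne {k l : ℕ} (h : l ≠ k + 1) :
    badImg bad (k + 1) l = (badImg bad k l).image HiggsLattice.blockOf := if_neg h

/-- The block point of an image point is an image point one level up (`l ≤ k`). [cite: Balaban1982Higgs2, (3.49) p.593] -/
theorem blockOf_mem_badImg_succ {k l : ℕ} (hlk : l ≤ k) {w : HiggsLattice.Site P k} (hw : w ∈ badImg bad k l) :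
    HiggsLattice.blockOf w ∈ badImg bad (k + 1) l := by
  rw [badImg_succ_of_ne (by omega)]
  exact Finset.mem_image_of_mem _ hw

/-- Above its own level there is nothing: `badImg bad k l = ∅` for `k < l`. [cite: Balaban1982Higgs2, (3.49) p.593] -/
theorem badImg_eq_empty : ∀ {k l : ℕ}, k < l → badImg bad k l = ∅
  | 0, l, h => if_neg (by omega)
  | k + 1, l, h => by
      rw [badImg_succ_of_ne (by omega), badImg_eq_empty (by omega : k < l), Finset.image_empty]

/-- **The images are no more numerous than the large-field points**: `|badImg bad k l| ≤ |bad l|`.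
[cite: Balaban1982Higgs2, (3.50) p.593] -/
theorem card_badImg_le : ∀ (k l : ℕ), (badImg bad k l).card ≤ (bad l).card
  | 0, l => by
      by_cases h : l = 0
      · subst h; rw [badImg_self]
      · rw [show badImg bad 0 l = ∅ from if_neg h]; simp
  | k + 1, l => by
      by_cases h : l = k + 1
      · subst h; rw [badImg_self]
      · rw [badImg_succ_of_ne h]
        exact Finset.card_image_le.trans (card_badImg_le k l)

end Images

/-! ## §3 The covering *"Λ₀^{(k)c} ⊂ ⋃_{□∈𝒟_k} □"* for the constructed regions, with explicit radii -/

section Cover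

/-- **The radii of the covering** (the printed recursion *"corridor + rescaling"* of (3.49)–(3.50) in this construction's
constants; `D = LM − 1` = the diameter of a large block): at its own level `rad r k k i = i·(r_k + 2D) + r_k + D` (the
thickness of `Λ_i^{(k)c}` towards the large fields of the step), below it
`rad r (k+1) l i = i·(r_{k+1} + 2D) + D + rad r k l 7 / L + 1` (the thickness towards the straddling large blocks, one large
block, the rescaled `Λ₇^{(k)c}`-corridor, the rounding). Values for `l > k` are unused. [cite: Balaban1982Higgs2, (3.50) p.593] -/
noncomputable def rad (P : HiggsLattice.Params) (r : ℕ → ℝ) : ℕ → ℕ → ℕ → ℝ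
  | 0, _, i => (i : ℝ) * (r 0 + 2 * ((P.L : ℝ) * P.M - 1)) + r 0 + ((P.L : ℝ) * P.M - 1)
  | k + 1, l, i =>
      if l = k + 1 then (i : ℝ) * (r (k + 1) + 2 * ((P.L : ℝ) * P.M - 1)) + r (k + 1) + ((P.L : ℝ) * P.M - 1)
      else (i : ℝ) * (r (k + 1) + 2 * ((P.L : ℝ) * P.M - 1)) + ((P.L : ℝ) * P.M - 1) + rad P r k l 7 / (P.L : ℝ) + 1

variable {bad : (j : ℕ) → Finset (HiggsLattice.Site P j)} {r : ℕ → ℝ}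

/-- The own-level radius. [cite: Balaban1982Higgs2, (3.48) p.593] -/
theorem rad_self (k i : ℕ) :
    rad P r k k i = (i : ℝ) * (r k + 2 * ((P.L : ℝ) * P.M - 1)) + r k + ((P.L : ℝ) * P.M - 1) := by
  cases k with
  | zero => rfl
  | succ k => exact if_pos rfl

/-- The recursion one level up (`l ≠ k + 1`). [cite: Balaban1982Higgs2, (3.49) p.593] -/
theorem rad_succ_of_ne {k l : ℕ} (h : l ≠ k + 1) (i : ℕ) :
    rad P r (k + 1) l i = (i : ℝ) * (r (k + 1) + 2 * ((P.L : ℝ) * P.M - 1)) + ((P.L : ℝ) * P.M - 1)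
      + rad P r k l 7 / (P.L : ℝ) + 1 :=
  if_neg h

/-- The tower with `Finset`-valued large-field data (coerced to sets for `towerRegion`). [cite: Balaban1982Higgs2, (2.43) p.566] -/
noncomputable abbrev towerRegionF (bad : (j : ℕ) → Finset (HiggsLattice.Site P j)) (r : ℕ → ℝ) (k i : ℕ) :
    Finset (HiggsLattice.Site P k) :=
  towerRegion (fun j => (↑(bad j) : Set (HiggsLattice.Site P j))) r k i

/-- A point outside the window `Λ₇^{(k)′}` is the block point of a point outside `Λ₇^{(k)}`. [cite: Balaban1982Higgs2, (3.22) p.588] -/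
theorem exists_of_not_mem_prime {k : ℕ} {Λ : Finset (HiggsLattice.Site P k)} {y : HiggsLattice.Site P (k + 1)}
    (hy : y ∉ prime Λ) : ∃ u : HiggsLattice.Site P k, HiggsLattice.blockOf u = y ∧ u ∉ Λ := by
  rw [mem_prime] at hy
  push Not at hy
  exact hy

/-- **The covering of (3.48)–(3.50) for the constructed regions**: every point of `Λ_i^{(k)c}` (`k ≤ K`) lies within distance
`rad r k l i` of the level-`k` image of a large-field point of some step `l ≤ k` — at its own level by the thickness of the
construction towards the large fields and the straddling large blocks (`B2Eq255RegionsWindow`), below by *"the definition of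
Λ₀^{(k)}"* ⊂ `Λ₇^{(k−1)′}` and the rescaling `tdist_blockOf_le`, inductively. [cite: Balaban1982Higgs2, (3.50) p.593] -/
theorem exists_badImg_near_of_not_mem_towerRegion :
    ∀ (k : ℕ), k ≤ P.K → ∀ (i : ℕ) {x : HiggsLattice.Site P k}, x ∉ towerRegionF bad r k i →
      ∃ l, l ≤ k ∧ ∃ w ∈ badImg bad k l, (HiggsLattice.Site.tdist x w : ℝ) ≤ rad P r k l i
  | 0, _, i, x, hx => by
      rw [towerRegionF, towerRegion_zero] at hx
      obtain ⟨z, hz, hd⟩ := exists_bad_near_of_not_mem_region i hx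
      refine ⟨0, le_rfl, z, ?_, ?_⟩
      · rw [badImg_self]; exact Finset.mem_coe.mp hz
      · rw [rad_self]
        have : ((i : ℝ) + 1) * r 0 + (2 * (i : ℝ) + 1) * ((P.L : ℝ) * P.M - 1)
            = (i : ℝ) * (r 0 + 2 * ((P.L : ℝ) * P.M - 1)) + r 0 + ((P.L : ℝ) * P.M - 1) := by ring
        rw [← this]; exact hd.le
  | k + 1, hk, i, x, hx => by
      rw [towerRegionF, towerRegion_succ] at hx
      obtain ⟨y, hy, hxy⟩ := exists_seed_near_of_not_mem_regionRel i hx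
      rcases (mem_relSeed.mp hy) with hW | hbad
      · -- the large block of `y` is not inside the window `Λ₇^{(k)′}`: a point `y′` of it lies outside the window
        obtain ⟨y', hy', hy'W⟩ : ∃ y', y' ∈ largeBlock (largeBlockOf y) ∧ y' ∉ prime (towerRegionF bad r k 7) := by
          by_contra h
          push Not at h
          exact hW h
        have hyy' : (HiggsLattice.Site.tdist y y' : ℝ) ≤ (P.L : ℝ) * P.M - 1 :=
          tdist_le_of_largeBlockOf_eq_real (mem_largeBlock.mp hy').symm
        obtain ⟨u, hu, huΛ⟩ := exists_of_not_mem_prime hy'W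
        obtain ⟨l, hl, w, hw, huw⟩ := exists_badImg_near_of_not_mem_towerRegion k (by omega) 7 huΛ
        refine ⟨l, by omega, HiggsLattice.blockOf w, blockOf_mem_badImg_succ hl hw, ?_⟩
        have hk' : k < P.K := by omega
        have hresc := tdist_blockOf_le_real hk' u w
        rw [hu] at hresc
        have hL : (0 : ℝ) < P.L := by exact_mod_cast P.hL
        have hdiv : (HiggsLattice.Site.tdist u w : ℝ) / (P.L : ℝ) ≤ rad P r k l 7 / (P.L : ℝ) :=
          div_le_div_of_nonneg_right huw hL.le
        rw [rad_succ_of_ne (by omega)]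
        calc (HiggsLattice.Site.tdist x (HiggsLattice.blockOf w) : ℝ)
            ≤ (HiggsLattice.Site.tdist x y : ℝ) + (HiggsLattice.Site.tdist y (HiggsLattice.blockOf w) : ℝ) :=
              tdist_triangle_real _ _ _
          _ ≤ (HiggsLattice.Site.tdist x y : ℝ) + ((HiggsLattice.Site.tdist y y' : ℝ)
                + (HiggsLattice.Site.tdist y' (HiggsLattice.blockOf w) : ℝ)) :=
              add_le_add le_rfl (tdist_triangle_real _ _ _)
          _ ≤ (i : ℝ) * (r (k + 1) + 2 * ((P.L : ℝ) * P.M - 1)) + (((P.L : ℝ) * P.M - 1)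
                + (rad P r k l 7 / (P.L : ℝ) + 1)) :=
              add_le_add hxy (add_le_add hyy' (hresc.trans (by linarith)))
          _ = (i : ℝ) * (r (k + 1) + 2 * ((P.L : ℝ) * P.M - 1)) + ((P.L : ℝ) * P.M - 1)
                + rad P r k l 7 / (P.L : ℝ) + 1 := by ring
      · -- the large block of `y` is near a large-field point of the step
        obtain ⟨z, hz, hyz⟩ := exists_bad_near_of_mem_regionCompl_zero hbad
        refine ⟨k + 1, le_rfl, z, ?_, ?_⟩
        · rw [badImg_self]; exact Finset.mem_coe.mp hz
        · rw [rad_self]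
          calc (HiggsLattice.Site.tdist x z : ℝ) ≤ (HiggsLattice.Site.tdist x y : ℝ) + (HiggsLattice.Site.tdist y z : ℝ) :=
                tdist_triangle_real _ _ _
            _ ≤ (i : ℝ) * (r (k + 1) + 2 * ((P.L : ℝ) * P.M - 1)) + (r (k + 1) + ((P.L : ℝ) * P.M - 1)) :=
                add_le_add hxy hyz.le
            _ = _ := by ring

end Cover

/-! ## §4 The count `|Λ_i^{(k)c}| ≤ Σ_{l ≤ k} |bad_l| · (2ρ_{k,l} + 1)^d` -/

section Count

variable {bad : (j : ℕ) → Finset (HiggsLattice.Site P j)} {r : ℕ → ℝ}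

/-- A real bound on the (integer) distance puts the point into the ball of the floored radius. [cite: Balaban1982Higgs1, (1.3) p.604] -/
theorem mem_ball_of_tdist_le {k : ℕ} {w x : HiggsLattice.Site P k} {ρ : ℝ} (h : (HiggsLattice.Site.tdist x w : ℝ) ≤ ρ) :
    x ∈ ball w ⌊ρ⌋₊ := by
  rw [mem_ball, tdist_comm]
  exact Nat.le_floor h

/-- **`Λ_i^{(k)c}` lies in the union, over the steps `l ≤ k` and their large-field images, of balls of radius `⌊rad r k l i⌋`**
(the concrete `Λ₀^{(k)c} ⊂ ⋃_{□∈𝒟_k} □`). [cite: Balaban1982Higgs2, (3.50) p.593] -/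
theorem compl_towerRegion_subset_biUnion {k : ℕ} (hk : k ≤ P.K) (i : ℕ) :
    (towerRegionF bad r k i)ᶜ ⊆ (Finset.range (k + 1)).biUnion fun l =>
      (badImg bad k l).biUnion fun w => ball w ⌊rad P r k l i⌋₊ := by
  intro x hx
  obtain ⟨l, hl, w, hw, hd⟩ := exists_badImg_near_of_not_mem_towerRegion k hk i (Finset.mem_compl.mp hx)
  exact Finset.mem_biUnion.mpr ⟨l, Finset.mem_range.mpr (by omega), Finset.mem_biUnion.mpr ⟨w, hw, mem_ball_of_tdist_le hd⟩⟩

/-- **The volume of `Λ_i^{(k)c}` by the numbers of large-field points of the steps `0, …, k`** (`k ≤ K`):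
`|Λ_i^{(k)c}| ≤ Σ_{l ≤ k} |bad_l| · (2⌊rad r k l i⌋ + 1)^d` — the shape of (3.50) (per earlier step, a coefficient to the
`d`-th power times the number of its large-field elements) for the constructed regions. [cite: Balaban1982Higgs2, (3.50) p.593] -/
theorem card_compl_towerRegion_le {k : ℕ} (hk : k ≤ P.K) (i : ℕ) :
    ((towerRegionF bad r k i)ᶜ).card ≤
      ∑ l ∈ Finset.range (k + 1), (bad l).card * (2 * ⌊rad P r k l i⌋₊ + 1) ^ P.d := by
  refine (Finset.card_le_card (compl_towerRegion_subset_biUnion hk i)).trans ?_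
  refine Finset.card_biUnion_le.trans (Finset.sum_le_sum fun l _ => ?_)
  refine Finset.card_biUnion_le.trans ?_
  calc ∑ w ∈ badImg bad k l, (ball w ⌊rad P r k l i⌋₊).card
      ≤ ∑ _w ∈ badImg bad k l, (2 * ⌊rad P r k l i⌋₊ + 1) ^ P.d := Finset.sum_le_sum fun w _ => card_ball_le w _
    _ = (badImg bad k l).card * (2 * ⌊rad P r k l i⌋₊ + 1) ^ P.d := by rw [Finset.sum_const, smul_eq_mul]
    _ ≤ (bad l).card * (2 * ⌊rad P r k l i⌋₊ + 1) ^ P.d := Nat.mul_le_mul_right _ (card_badImg_le k l)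

/-- The first step (`k = 0`, `i = 0`) is gen-8's one-level count: `|Λ₀^{(0)c}| ≤ |bad_0| · (2⌊r + (LM − 1)⌋ + 1)^d` — cf. (3.48)
with (3.44). [cite: Balaban1982Higgs2, (3.48) p.593] -/
theorem card_compl_towerRegion_zero_le :
    ((towerRegionF bad r 0 0)ᶜ).card ≤ (bad 0).card * (2 * ⌊r 0 + ((P.L : ℝ) * P.M - 1)⌋₊ + 1) ^ P.d := by
  have h := card_compl_towerRegion_le (bad := bad) (r := r) (k := 0) (Nat.zero_le _) 0
  rw [Finset.sum_range_one, rad_self] at h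
  simpa using h

end Count

end Literature.MathematicalPhysics.QuantumFieldTheory.Balaban1983to89.B2Eq350TowerVolume
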